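import Summits.NavierStokesRegularity.OSWSelfSimilar.SheetRLinearisedUniqueness
import Summits.NavierStokesRegularity.OSWSelfSimilar.SheetRWeightedMeasure
import Mathlib.Analysis.InnerProductSpace.ProdL2
import Mathlib.MeasureTheory.Function.L2Space
import HarnessLib

/-!
# SHEET-ℝ frame, MODEL ASSEMBLY layer 3a: the pivot space `L²_w` and the energy space `E` as HILBERT SPACES over Mathlib

HONEST FRAMING (cell ns-blowup GROUP B / zone Z3, cases Z3-SR-CERT / Z3-SR-SPEC; 1-D MODEL certificate frame (viscous gCLM/OSW sheet on the
line); not Euler/NS; «violates: none — MODEL»). Nothing here asserts that a profile exists.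

The certificate rows (`CertificateViscousSheetRFixedPoint.existsUnique_fixedPoint_of_row_w`, cert-4's pencil/resolvent files, Lions' theorem in
operator form `Literature.Analysis.OperatorTheory.exists_solutionOperator_of_coercive`) quantify over ABSTRACT Banach/Hilbert spaces `E`, `W`.
This file builds the sheet's concrete ones:

* `μw L = (L² + ξ²)·dξ` (Mathlib `withDensity`; dictionary `SheetRWeightedMeasure`), **`W L := Lp ℝ 2 (μw L)`** — the frame's `L²_w`, a real
  Hilbert space; for `g : W L`: `g` is a.e.-strongly measurable for Lebesgue measure, `∫ w g² < ∞`, `‖g‖² = ∫ w g²` (`sq_norm_W`);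
* the primitive `prim g = ∫₀ g` of `g : W L`: well defined on a.e.-classes, additive, homogeneous, bounded (`|prim g x| ≤ √(π/L)‖g‖`);
* **`Esp L`** — the ENERGY SPACE as a CLOSED submodule of the Hilbert space `WithLp 2 (W L × W L)`: pairs `p = (p₀, p₁)` with
  `∫₀ˣ (2p₀ − prim p₁) = 0` for every `x` (i.e. `2p₀` IS the primitive of `p₁`, a.e.) and `prim p₁` odd — an intersection of kernels of
  continuous linear functionals, hence closed, hence COMPLETE (`completeSpace_Esp`), with the inner product inherited from `L²_w × L²_w`:
  `‖p‖² = ‖p₀‖²_w + ‖p₁‖²_w = ¼‖u‖²_w + ‖u₁‖²_w = ‖u‖²_E` for the profile `u = prim p₁ = 2p₀`, `u₁ = p₁`;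
* `energyClass_of_mem` — the dictionary back to the frame's function language: for `p ∈ Esp L` the pair `(u, u₁) = (prim p₁, p₁)` is in the
  odd energy class in the primitive form of record (`u = u(0) + ∫₀u₁`, `u` odd, `u₁` a.e.-strongly measurable, `∫wu² < ∞`, `∫wu₁² < ∞`), with
  `u = 2p₀` a.e. and `∫ w u² = 4‖p₀‖²`.
Three definitions (`μw`, `prim`, `Esp`); no named fact. WHAT THIS IS NOT: not NS; no number of record moves; the solution operator itself is
`SheetRSolutionOperator.lean`.
-/

noncomputable section

namespace Summit.NavierStokesRegularity.OSWSelfSimilar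
namespace SheetREnergySpace

open _root_.MeasureTheory _root_.Set _root_.Filter _root_.Real SheetRWeakProfilePV SheetRWeakToStrong SheetREnergyClass SheetRWeightedMeasure
open scoped Topology ENNReal

/-! ### §1 The pivot space `W L = L²((L² + ξ²)dξ)` -/

/-- The weighted measure `μ_w = (L² + ξ²)·dξ`. [folklore] -/
def μw (L : ℝ) : Measure ℝ := volume.withDensity fun y : ℝ => ENNReal.ofReal (L ^ 2 + y ^ 2)

/-- Unfolding `μw`. [folklore] -/
theorem μw_eq (L : ℝ) : μw L = volume.withDensity fun y : ℝ => ENNReal.ofReal (L ^ 2 + y ^ 2) := rfl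

/-- The pivot space `L²_w`. [folklore] -/
abbrev W (L : ℝ) : Type := Lp ℝ 2 (μw L)

/-- Lebesgue measure is absolutely continuous with respect to `μ_w` (`L > 0`: the density is positive). [folklore] -/
theorem volume_absolutelyContinuous_μw {L : ℝ} (hL : 0 < L) : (volume : Measure ℝ) ≪ μw L := by
  rw [μw_eq]
  refine withDensity_absolutelyContinuous' (measurable_weight L).aemeasurable (Eventually.of_forall fun y => ?_)
  have : 0 < L ^ 2 + y ^ 2 := by positivity
  exact (ENNReal.ofReal_pos.2 this).ne'

/-- An element of `W L` is a.e.-strongly measurable for Lebesgue measure. [folklore] -/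
theorem aestronglyMeasurable_of_W {L : ℝ} (hL : 0 < L) (g : W L) : AEStronglyMeasurable (g : ℝ → ℝ) volume :=
  (Lp.aestronglyMeasurable g).mono_ac (volume_absolutelyContinuous_μw hL)

/-- For `g : W L`: `∫ (L² + ξ²) g² < ∞`. [folklore] -/
theorem weightedSq_of_W {L : ℝ} (hL : 0 < L) (g : W L) : Integrable fun y => (L ^ 2 + y ^ 2) * (g : ℝ → ℝ) y ^ 2 :=
  (memLp_two_withDensity_weight_iff (aestronglyMeasurable_of_W hL g)).1 (Lp.memLp g)

/-- For `g : W L`: `‖g‖ = (∫ (L² + ξ²) g²)^{1/2}`. [folklore] -/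
theorem norm_W {L : ℝ} (g : W L) : ‖g‖ = Real.sqrt (∫ y, (L ^ 2 + y ^ 2) * (g : ℝ → ℝ) y ^ 2) := by
  rw [Lp.norm_def]; exact toReal_eLpNorm_two_withDensity_weight (Lp.memLp g)

/-- For `g : W L`: `‖g‖² = ∫ (L² + ξ²) g²`. [folklore] -/
theorem sq_norm_W {L : ℝ} (g : W L) : ‖g‖ ^ 2 = ∫ y, (L ^ 2 + y ^ 2) * (g : ℝ → ℝ) y ^ 2 := by
  rw [norm_W, Real.sq_sqrt (integral_nonneg fun y => by positivity)]

/-- `μ_w`-a.e. equalities are Lebesgue-a.e. equalities (`L > 0`). [folklore] -/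
theorem ae_volume_of_ae_μw {L : ℝ} (hL : 0 < L) {f g : ℝ → ℝ} (h : f =ᵐ[μw L] g) : f =ᵐ[volume] g :=
  (volume_absolutelyContinuous_μw hL).ae_le h

/-- A function with `∫ (L²+ξ²)g² < ∞` defines an element of `W L`; its class is a.e. equal to it. [folklore] -/
theorem memLp_W {L : ℝ} {g : ℝ → ℝ} (hg : AEStronglyMeasurable g volume) (h : Integrable fun y => (L ^ 2 + y ^ 2) * g y ^ 2) :
    MemLp g 2 (μw L) :=
  (memLp_two_withDensity_weight_iff hg).2 h

/-! ### §2 The primitive of an element of `W L` -/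

/-- The primitive `prim g (x) = ∫₀ˣ g`. [folklore] -/
def prim (g : ℝ → ℝ) (x : ℝ) : ℝ := ∫ s in (0 : ℝ)..x, g s

/-- Unfolding `prim`. [folklore] -/
theorem prim_apply (g : ℝ → ℝ) (x : ℝ) : prim g x = ∫ s in (0 : ℝ)..x, g s := rfl

/-- `prim g 0 = 0`. [folklore] -/
@[simp] theorem prim_zero_right (g : ℝ → ℝ) : prim g 0 = 0 := by simp [prim]

/-- `prim` only depends on the Lebesgue-a.e. class. [folklore] -/
theorem prim_congr_ae {f g : ℝ → ℝ} (h : f =ᵐ[volume] g) : prim f = prim g := by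
  funext x
  exact intervalIntegral.integral_congr_ae (h.mono fun y hy _ => hy)

/-- Elements of `W L` are locally integrable (indeed in `L²`): interval integrability. [folklore] -/
theorem intervalIntegrable_of_W {L : ℝ} (hL : 0 < L) (g : W L) (a b : ℝ) : IntervalIntegrable (g : ℝ → ℝ) volume a b :=
  intervalIntegrable_of_memLp_two (memLp_two_of_weighted_sq hL (aestronglyMeasurable_of_W hL g) (weightedSq_of_W hL g)) a b

/-- **Boundedness of the primitive**: `|prim g x| ≤ √(π/L)·‖g‖` (`L²_w ⊂ L¹`). [folklore] -/
theorem abs_prim_le {L : ℝ} (hL : 0 < L) (g : W L) (x : ℝ) : |prim (g : ℝ → ℝ) x| ≤ Real.sqrt (π / L) * ‖g‖ := by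
  have hgi : Integrable (g : ℝ → ℝ) :=
    SheetRWeightedEmbeddings.integrable_of_weighted_sq hL (aestronglyMeasurable_of_W hL g) (weightedSq_of_W hL g)
  have h1 : |prim (g : ℝ → ℝ) x| ≤ ∫ y, |(g : ℝ → ℝ) y| := by
    rw [prim_apply, ← Real.norm_eq_abs]
    calc ‖∫ s in (0 : ℝ)..x, (g : ℝ → ℝ) s‖ ≤ ∫ s in Set.uIoc 0 x, ‖(g : ℝ → ℝ) s‖ :=
          intervalIntegral.norm_integral_le_integral_norm_uIoc
      _ ≤ ∫ y, ‖(g : ℝ → ℝ) y‖ := setIntegral_le_integral hgi.norm (Eventually.of_forall fun y => norm_nonneg _)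
      _ = ∫ y, |(g : ℝ → ℝ) y| := by simp only [Real.norm_eq_abs]
  rw [norm_W]
  exact h1.trans (SheetRWeightedEmbeddings.integral_abs_le_of_weighted_sq hL (aestronglyMeasurable_of_W hL g) (weightedSq_of_W hL g))

/-- `prim` is additive on `W L`. [folklore] -/
theorem prim_add {L : ℝ} (hL : 0 < L) (f g : W L) :
    prim ((f + g : W L) : ℝ → ℝ) = fun x => prim (f : ℝ → ℝ) x + prim (g : ℝ → ℝ) x := by
  have hae : ((f + g : W L) : ℝ → ℝ) =ᵐ[volume] fun y => (f : ℝ → ℝ) y + (g : ℝ → ℝ) y :=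
    ae_volume_of_ae_μw hL (Lp.coeFn_add f g)
  rw [prim_congr_ae hae]
  funext x
  simp only [prim]
  exact intervalIntegral.integral_add (intervalIntegrable_of_W hL f 0 x) (intervalIntegrable_of_W hL g 0 x)

/-- `prim` is homogeneous on `W L`. [folklore] -/
theorem prim_smul {L : ℝ} (hL : 0 < L) (c : ℝ) (f : W L) :
    prim ((c • f : W L) : ℝ → ℝ) = fun x => c * prim (f : ℝ → ℝ) x := by
  have hae : ((c • f : W L) : ℝ → ℝ) =ᵐ[volume] fun y => c * (f : ℝ → ℝ) y := by
    have h := ae_volume_of_ae_μw hL (Lp.coeFn_smul c f)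
    exact h.mono fun y hy => by rw [hy, Pi.smul_apply, smul_eq_mul]
  rw [prim_congr_ae hae]
  funext x
  simp only [prim]
  exact intervalIntegral.integral_const_mul c _

/-- `prim g` is continuous. [folklore] -/
theorem continuous_prim {L : ℝ} (hL : 0 < L) (g : W L) : Continuous (prim (g : ℝ → ℝ)) :=
  intervalIntegral.continuous_primitive (intervalIntegrable_of_W hL g) 0

/-! ### §3 The energy space `Esp L` as a closed submodule of `W L × W L` (with the `ℓ²` product norm) -/

/-- **The energy space.** Pairs `p = (p₀, p₁) ∈ L²_w × L²_w` such that `2p₀` is the primitive of `p₁` (tested by `∫₀ˣ (2p₀ − prim p₁) = 0`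
for every `x`) and `prim p₁` is odd.  For the profile `u := prim p₁` (`= 2p₀` a.e.), `u₁ := p₁`: `‖p‖² = ¼‖u‖²_w + ‖u₁‖²_w = ‖u‖²_E`. [folklore] -/
def Esp (L : ℝ) (hL : 0 < L) : Submodule ℝ (WithLp 2 (W L × W L)) where
  carrier := {p | (∀ x, ∫ s in (0 : ℝ)..x, (2 * (p.fst : ℝ → ℝ) s - prim (p.snd : ℝ → ℝ) s) = 0) ∧
    ∀ x, prim (p.snd : ℝ → ℝ) (-x) = -prim (p.snd : ℝ → ℝ) x}
  add_mem' := by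
    intro p q hp hq
    refine ⟨fun x => ?_, fun x => ?_⟩
    · have hae : ((p + q).fst : ℝ → ℝ) =ᵐ[volume] fun y => (p.fst : ℝ → ℝ) y + (q.fst : ℝ → ℝ) y := by
        rw [WithLp.add_fst]; exact ae_volume_of_ae_μw hL (Lp.coeFn_add _ _)
      rw [WithLp.add_snd, prim_add hL]
      have hcongr : ∫ s in (0 : ℝ)..x, (2 * ((p + q).fst : ℝ → ℝ) s - (prim (p.snd : ℝ → ℝ) s + prim (q.snd : ℝ → ℝ) s)) =
          ∫ s in (0 : ℝ)..x, ((2 * (p.fst : ℝ → ℝ) s - prim (p.snd : ℝ → ℝ) s) + (2 * (q.fst : ℝ → ℝ) s - prim (q.snd : ℝ → ℝ) s)) :=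
        intervalIntegral.integral_congr_ae (hae.mono fun y hy _ => by rw [hy]; ring)
      rw [hcongr, intervalIntegral.integral_add, hp.1 x, hq.1 x, add_zero]
      · exact ((intervalIntegrable_of_W hL p.fst 0 x).const_mul 2).sub ((continuous_prim hL p.snd).intervalIntegrable 0 x)
      · exact ((intervalIntegrable_of_W hL q.fst 0 x).const_mul 2).sub ((continuous_prim hL q.snd).intervalIntegrable 0 x)
    · rw [WithLp.add_snd, prim_add hL]
      simp only [hp.2 x, hq.2 x]
      ring
  zero_mem' := by
    refine ⟨fun x => ?_, fun x => ?_⟩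
    · have hae : ((0 : WithLp 2 (W L × W L)).fst : ℝ → ℝ) =ᵐ[volume] 0 := by
        rw [WithLp.zero_fst]; exact ae_volume_of_ae_μw hL (Lp.coeFn_zero _ _ _)
      have hae2 : ((0 : WithLp 2 (W L × W L)).snd : ℝ → ℝ) =ᵐ[volume] 0 := by
        rw [WithLp.zero_snd]; exact ae_volume_of_ae_μw hL (Lp.coeFn_zero _ _ _)
      rw [prim_congr_ae hae2]
      have hcongr : ∫ s in (0 : ℝ)..x, (2 * ((0 : WithLp 2 (W L × W L)).fst : ℝ → ℝ) s - prim (0 : ℝ → ℝ) s) =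
          ∫ s in (0 : ℝ)..x, (0 : ℝ) :=
        intervalIntegral.integral_congr_ae (hae.mono fun y hy _ => by rw [hy]; simp [prim])
      rw [hcongr, intervalIntegral.integral_zero]
    · have hae2 : ((0 : WithLp 2 (W L × W L)).snd : ℝ → ℝ) =ᵐ[volume] 0 := by
        rw [WithLp.zero_snd]; exact ae_volume_of_ae_μw hL (Lp.coeFn_zero _ _ _)
      rw [prim_congr_ae hae2]
      simp [prim]
  smul_mem' := by
    intro c p hp
    refine ⟨fun x => ?_, fun x => ?_⟩
    · have hae : ((c • p).fst : ℝ → ℝ) =ᵐ[volume] fun y => c * (p.fst : ℝ → ℝ) y := by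
        rw [WithLp.smul_fst]
        exact (ae_volume_of_ae_μw hL (Lp.coeFn_smul c _)).mono fun y hy => by rw [hy, Pi.smul_apply, smul_eq_mul]
      rw [WithLp.smul_snd, prim_smul hL]
      have hcongr : ∫ s in (0 : ℝ)..x, (2 * ((c • p).fst : ℝ → ℝ) s - c * prim (p.snd : ℝ → ℝ) s) =
          ∫ s in (0 : ℝ)..x, c * (2 * (p.fst : ℝ → ℝ) s - prim (p.snd : ℝ → ℝ) s) :=
        intervalIntegral.integral_congr_ae (hae.mono fun y hy _ => by rw [hy]; ring)
      rw [hcongr, intervalIntegral.integral_const_mul, hp.1 x, mul_zero]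
    · rw [WithLp.smul_snd, prim_smul hL]
      simp only [hp.2 x]
      ring

/-- Membership in `Esp L`, unfolded. [folklore] -/
theorem mem_Esp_iff {L : ℝ} (hL : 0 < L) (p : WithLp 2 (W L × W L)) :
    p ∈ Esp L hL ↔ (∀ x, ∫ s in (0 : ℝ)..x, (2 * (p.fst : ℝ → ℝ) s - prim (p.snd : ℝ → ℝ) s) = 0) ∧
      ∀ x, prim (p.snd : ℝ → ℝ) (-x) = -prim (p.snd : ℝ → ℝ) x := Iff.rfl

/-- The first defining family of functionals is continuous: `p ↦ ∫₀ˣ (2p₀ − prim p₁)`. [folklore] -/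
theorem continuous_functional₁ {L : ℝ} (hL : 0 < L) (x : ℝ) :
    Continuous fun p : WithLp 2 (W L × W L) => ∫ s in (0 : ℝ)..x, (2 * (p.fst : ℝ → ℝ) s - prim (p.snd : ℝ → ℝ) s) := by
  -- it is a linear map with the bound `(2√(π/L) + |x|√(π/L))‖p‖`
  set Λ : WithLp 2 (W L × W L) →ₗ[ℝ] ℝ :=
    { toFun := fun p => ∫ s in (0 : ℝ)..x, (2 * (p.fst : ℝ → ℝ) s - prim (p.snd : ℝ → ℝ) s)
      map_add' := by
        intro p q
        have hae : ((p + q).fst : ℝ → ℝ) =ᵐ[volume] fun y => (p.fst : ℝ → ℝ) y + (q.fst : ℝ → ℝ) y := by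
          rw [WithLp.add_fst]; exact ae_volume_of_ae_μw hL (Lp.coeFn_add _ _)
        show ∫ s in (0 : ℝ)..x, (2 * ((p + q).fst : ℝ → ℝ) s - prim ((p + q).snd : ℝ → ℝ) s) = _
        rw [WithLp.add_snd, prim_add hL]
        have hcongr : ∫ s in (0 : ℝ)..x, (2 * ((p + q).fst : ℝ → ℝ) s - (prim (p.snd : ℝ → ℝ) s + prim (q.snd : ℝ → ℝ) s)) =
            ∫ s in (0 : ℝ)..x, ((2 * (p.fst : ℝ → ℝ) s - prim (p.snd : ℝ → ℝ) s) + (2 * (q.fst : ℝ → ℝ) s - prim (q.snd : ℝ → ℝ) s)) :=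
          intervalIntegral.integral_congr_ae (hae.mono fun y hy _ => by rw [hy]; ring)
        rw [hcongr, intervalIntegral.integral_add]
        · exact ((intervalIntegrable_of_W hL p.fst 0 x).const_mul 2).sub ((continuous_prim hL p.snd).intervalIntegrable 0 x)
        · exact ((intervalIntegrable_of_W hL q.fst 0 x).const_mul 2).sub ((continuous_prim hL q.snd).intervalIntegrable 0 x)
      map_smul' := by
        intro c p
        have hae : ((c • p).fst : ℝ → ℝ) =ᵐ[volume] fun y => c * (p.fst : ℝ → ℝ) y := by
          rw [WithLp.smul_fst]
          exact (ae_volume_of_ae_μw hL (Lp.coeFn_smul c _)).mono fun y hy => by rw [hy, Pi.smul_apply, smul_eq_mul]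
        show ∫ s in (0 : ℝ)..x, (2 * ((c • p).fst : ℝ → ℝ) s - prim ((c • p).snd : ℝ → ℝ) s) = (RingHom.id ℝ) c • _
        rw [RingHom.id_apply, smul_eq_mul, WithLp.smul_snd, prim_smul hL]
        have hcongr : ∫ s in (0 : ℝ)..x, (2 * ((c • p).fst : ℝ → ℝ) s - c * prim (p.snd : ℝ → ℝ) s) =
            ∫ s in (0 : ℝ)..x, c * (2 * (p.fst : ℝ → ℝ) s - prim (p.snd : ℝ → ℝ) s) :=
          intervalIntegral.integral_congr_ae (hae.mono fun y hy _ => by rw [hy]; ring)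
        rw [hcongr, intervalIntegral.integral_const_mul] } with hΛ
  have hbound : ∀ p : WithLp 2 (W L × W L), ‖Λ p‖ ≤ (2 * Real.sqrt (π / L) + |x| * Real.sqrt (π / L)) * ‖p‖ := by
    intro p
    rw [Real.norm_eq_abs]
    have h1 : |∫ s in (0 : ℝ)..x, 2 * (p.fst : ℝ → ℝ) s| ≤ 2 * Real.sqrt (π / L) * ‖p.fst‖ := by
      rw [intervalIntegral.integral_const_mul, abs_mul, abs_of_pos (by norm_num : (0:ℝ) < 2), mul_assoc]
      exact mul_le_mul_of_nonneg_left (abs_prim_le hL p.fst x) (by norm_num)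
    have h2 : |∫ s in (0 : ℝ)..x, prim (p.snd : ℝ → ℝ) s| ≤ |x| * (Real.sqrt (π / L) * ‖p.snd‖) := by
      have h := intervalIntegral.norm_integral_le_of_norm_le_const (a := 0) (b := x) (f := prim (p.snd : ℝ → ℝ))
        (C := Real.sqrt (π / L) * ‖p.snd‖) (fun s _ => by rw [Real.norm_eq_abs]; exact abs_prim_le hL p.snd s)
      rw [Real.norm_eq_abs, sub_zero] at h
      linarith [h, mul_comm (Real.sqrt (π / L) * ‖p.snd‖) |x|]
    have hsplit : ∫ s in (0 : ℝ)..x, (2 * (p.fst : ℝ → ℝ) s - prim (p.snd : ℝ → ℝ) s) =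
        (∫ s in (0 : ℝ)..x, 2 * (p.fst : ℝ → ℝ) s) - ∫ s in (0 : ℝ)..x, prim (p.snd : ℝ → ℝ) s :=
      intervalIntegral.integral_sub ((intervalIntegrable_of_W hL p.fst 0 x).const_mul 2)
        ((continuous_prim hL p.snd).intervalIntegrable 0 x)
    have hf : ‖p.fst‖ ≤ ‖p‖ := WithLp.norm_fst_le (x := p)
    have hs : ‖p.snd‖ ≤ ‖p‖ := WithLp.norm_snd_le (x := p)
    have hπ : 0 ≤ Real.sqrt (π / L) := Real.sqrt_nonneg _
    change |∫ s in (0 : ℝ)..x, (2 * (p.fst : ℝ → ℝ) s - prim (p.snd : ℝ → ℝ) s)| ≤ _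
    rw [hsplit]
    calc |(∫ s in (0 : ℝ)..x, 2 * (p.fst : ℝ → ℝ) s) - ∫ s in (0 : ℝ)..x, prim (p.snd : ℝ → ℝ) s|
        ≤ 2 * Real.sqrt (π / L) * ‖p.fst‖ + |x| * (Real.sqrt (π / L) * ‖p.snd‖) := (abs_sub _ _).trans (add_le_add h1 h2)
      _ ≤ 2 * Real.sqrt (π / L) * ‖p‖ + |x| * (Real.sqrt (π / L) * ‖p‖) := by gcongr
      _ = (2 * Real.sqrt (π / L) + |x| * Real.sqrt (π / L)) * ‖p‖ := by ring
  exact (Λ.mkContinuous _ hbound).continuous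

/-- The second defining family of functionals is continuous: `p ↦ prim p₁ (−x) + prim p₁ x`. [folklore] -/
theorem continuous_functional₂ {L : ℝ} (hL : 0 < L) (x : ℝ) :
    Continuous fun p : WithLp 2 (W L × W L) => prim (p.snd : ℝ → ℝ) (-x) + prim (p.snd : ℝ → ℝ) x := by
  set Λ : WithLp 2 (W L × W L) →ₗ[ℝ] ℝ :=
    { toFun := fun p => prim (p.snd : ℝ → ℝ) (-x) + prim (p.snd : ℝ → ℝ) x
      map_add' := by
        intro p q
        show prim ((p + q).snd : ℝ → ℝ) (-x) + prim ((p + q).snd : ℝ → ℝ) x = _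
        rw [WithLp.add_snd, prim_add hL]
        ring
      map_smul' := by
        intro c p
        show prim ((c • p).snd : ℝ → ℝ) (-x) + prim ((c • p).snd : ℝ → ℝ) x = (RingHom.id ℝ) c • _
        rw [WithLp.smul_snd, prim_smul hL, RingHom.id_apply, smul_eq_mul]
        ring } with hΛ
  have hbound : ∀ p : WithLp 2 (W L × W L), ‖Λ p‖ ≤ (2 * Real.sqrt (π / L)) * ‖p‖ := by
    intro p
    rw [Real.norm_eq_abs]
    have hs : ‖p.snd‖ ≤ ‖p‖ := WithLp.norm_snd_le (x := p)
    have h1 := abs_prim_le hL p.snd (-x)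
    have h2 := abs_prim_le hL p.snd x
    have hπ : 0 ≤ Real.sqrt (π / L) := Real.sqrt_nonneg _
    change |prim (p.snd : ℝ → ℝ) (-x) + prim (p.snd : ℝ → ℝ) x| ≤ _
    calc |prim (p.snd : ℝ → ℝ) (-x) + prim (p.snd : ℝ → ℝ) x| ≤ Real.sqrt (π / L) * ‖p.snd‖ + Real.sqrt (π / L) * ‖p.snd‖ :=
          (abs_add_le _ _).trans (add_le_add h1 h2)
      _ ≤ Real.sqrt (π / L) * ‖p‖ + Real.sqrt (π / L) * ‖p‖ := by gcongr
      _ = (2 * Real.sqrt (π / L)) * ‖p‖ := by ring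
  exact (Λ.mkContinuous _ hbound).continuous

/-- **`Esp L` is closed** in `W L × W L` (an intersection of kernels of continuous functionals). [folklore] -/
theorem isClosed_Esp {L : ℝ} (hL : 0 < L) : IsClosed (Esp L hL : Set (WithLp 2 (W L × W L))) := by
  have h : (Esp L hL : Set (WithLp 2 (W L × W L))) =
      (⋂ x : ℝ, {p | ∫ s in (0 : ℝ)..x, (2 * (p.fst : ℝ → ℝ) s - prim (p.snd : ℝ → ℝ) s) = 0}) ∩
        ⋂ x : ℝ, {p | prim (p.snd : ℝ → ℝ) (-x) + prim (p.snd : ℝ → ℝ) x = 0} := by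
    ext p
    simp only [SetLike.mem_coe, mem_Esp_iff, mem_inter_iff, mem_iInter, mem_setOf_eq]
    constructor
    · rintro ⟨h1, h2⟩; exact ⟨h1, fun x => by rw [h2 x]; ring⟩
    · rintro ⟨h1, h2⟩; exact ⟨h1, fun x => by linarith [h2 x]⟩
  rw [h]
  exact (isClosed_iInter fun x => isClosed_eq (continuous_functional₁ hL x) continuous_const).inter
    (isClosed_iInter fun x => isClosed_eq (continuous_functional₂ hL x) continuous_const)

/-- **`Esp L` is complete** (a closed subspace of a Hilbert space), hence a real Hilbert space with the inherited inner product. [folklore] -/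
theorem completeSpace_Esp {L : ℝ} (hL : 0 < L) : CompleteSpace (Esp L hL) :=
  (isClosed_Esp hL).completeSpace_coe

/-! ### §4 Back to the function language: elements of `Esp L` are odd energy-class profiles -/

/-- For `p ∈ Esp L`: `prim p₁ = 2p₀` almost everywhere (Lebesgue differentiation of `x ↦ ∫₀ˣ (2p₀ − prim p₁) ≡ 0`). [folklore] -/
theorem prim_snd_ae_eq {L : ℝ} (hL : 0 < L) (p : Esp L hL) :
    (fun y => prim ((p : WithLp 2 (W L × W L)).snd : ℝ → ℝ) y) =ᵐ[volume]
      fun y => 2 * ((p : WithLp 2 (W L × W L)).fst : ℝ → ℝ) y := by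
  obtain ⟨h1, -⟩ := (mem_Esp_iff hL _).1 p.2
  set f : ℝ → ℝ := fun y => 2 * ((p : WithLp 2 (W L × W L)).fst : ℝ → ℝ) y -
    prim ((p : WithLp 2 (W L × W L)).snd : ℝ → ℝ) y with hf
  have hfloc : LocallyIntegrable f volume := by
    have h1' : LocallyIntegrable (fun y => 2 * ((p : WithLp 2 (W L × W L)).fst : ℝ → ℝ) y) volume :=
      ((memLp_two_of_weighted_sq hL (aestronglyMeasurable_of_W hL _) (weightedSq_of_W hL _)).const_mul 2).locallyIntegrable
        one_le_two
    exact h1'.sub (continuous_prim hL _).locallyIntegrable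
  have hder := _root_.LocallyIntegrable.ae_hasDerivAt_integral hfloc
  have hF : (fun x => ∫ t in (0 : ℝ)..x, f t) = fun _ => (0 : ℝ) := funext fun x => h1 x
  filter_upwards [hder] with y hy
  have hy0 := hy 0
  rw [hF] at hy0
  have hzero : f y = 0 := (hy0.unique (hasDerivAt_const y (0 : ℝ)))
  simp only [hf] at hzero
  linarith

/-- **The dictionary.** For `p ∈ Esp L` the profile `u := prim p₁`, `u₁ := p₁` is in the odd energy class in the primitive form of record:
`u = u(0) + ∫₀u₁`, `u` odd, `u₁` a.e.-strongly measurable, `∫ w u₁² < ∞`, `∫ w u² < ∞` with `∫ w u² = 4‖p₀‖²` and `∫ w u₁² = ‖p₁‖²`. [folklore] -/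
theorem energyClass_of_mem {L : ℝ} (hL : 0 < L) (p : Esp L hL) :
    (∀ x, prim ((p : WithLp 2 (W L × W L)).snd : ℝ → ℝ) x = prim ((p : WithLp 2 (W L × W L)).snd : ℝ → ℝ) 0 +
      ∫ s in (0 : ℝ)..x, ((p : WithLp 2 (W L × W L)).snd : ℝ → ℝ) s) ∧
    (∀ y, prim ((p : WithLp 2 (W L × W L)).snd : ℝ → ℝ) (-y) = -prim ((p : WithLp 2 (W L × W L)).snd : ℝ → ℝ) y) ∧
    AEStronglyMeasurable (((p : WithLp 2 (W L × W L)).snd : ℝ → ℝ)) volume ∧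
    Integrable (fun y => (L ^ 2 + y ^ 2) * prim ((p : WithLp 2 (W L × W L)).snd : ℝ → ℝ) y ^ 2) ∧
    Integrable (fun y => (L ^ 2 + y ^ 2) * ((p : WithLp 2 (W L × W L)).snd : ℝ → ℝ) y ^ 2) ∧
    (∫ y, (L ^ 2 + y ^ 2) * prim ((p : WithLp 2 (W L × W L)).snd : ℝ → ℝ) y ^ 2) = 4 * ‖(p : WithLp 2 (W L × W L)).fst‖ ^ 2 ∧
    (∫ y, (L ^ 2 + y ^ 2) * ((p : WithLp 2 (W L × W L)).snd : ℝ → ℝ) y ^ 2) = ‖(p : WithLp 2 (W L × W L)).snd‖ ^ 2 := by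
  obtain ⟨-, h2⟩ := (mem_Esp_iff hL _).1 p.2
  have hae := prim_snd_ae_eq hL p
  have h0' : Integrable fun y => (L ^ 2 + y ^ 2) * (2 * ((p : WithLp 2 (W L × W L)).fst : ℝ → ℝ) y) ^ 2 := by
    have := (weightedSq_of_W hL (p : WithLp 2 (W L × W L)).fst).const_mul 4
    refine this.congr (Eventually.of_forall fun y => ?_)
    simp only; ring
  have hcongr : (fun y => (L ^ 2 + y ^ 2) * prim ((p : WithLp 2 (W L × W L)).snd : ℝ → ℝ) y ^ 2) =ᵐ[volume]
      fun y => (L ^ 2 + y ^ 2) * (2 * ((p : WithLp 2 (W L × W L)).fst : ℝ → ℝ) y) ^ 2 :=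
    hae.mono fun y hy => by simp only [hy]
  refine ⟨fun x => by simp [prim], h2, aestronglyMeasurable_of_W hL _, h0'.congr hcongr.symm, weightedSq_of_W hL _, ?_, ?_⟩
  · rw [integral_congr_ae hcongr, sq_norm_W]
    have e : (fun y => (L ^ 2 + y ^ 2) * (2 * ((p : WithLp 2 (W L × W L)).fst : ℝ → ℝ) y) ^ 2) =
        fun y => 4 * ((L ^ 2 + y ^ 2) * ((p : WithLp 2 (W L × W L)).fst : ℝ → ℝ) y ^ 2) := by
      funext y; ring
    rw [e, integral_const_mul]
  · rw [sq_norm_W]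

end SheetREnergySpace
end Summit.NavierStokesRegularity.OSWSelfSimilar

end
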